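import Summits.CriticalPhenomena.PercolationContinuityZ3.Theorems.Transplant.SiteKNExit
import Summits.CriticalPhenomena.PercolationContinuityZ3.Theorems.Transplant.SiteThmASocketLtOneZd
import Literature.Probability.Percolation.SiteBondCriticalPoints
import HarnessLib

/-!
# SITE Kozma–Nitzan §4 — the site same-`p` witness below density one, and `θ^{site}_{ℤ^d}(p_c^{site}) = 0` (`d ≥ 3`)
# from the site target property and the site Lemma 9

builds on p205010 (kernel theorem, internal audit signed; external expert review pending).
Lane `prim-bschramm`, class C1a (site percolation on `ℤ³`); block (γ) of the SITE same-`p` witness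
(`SiteSameP.SiteSamePWitnessZd`, socket p217536, `Transplant/SiteThmASocketZd.lean`), prim-hp-8 lineage.  Site twin of
`KSch.hQ0_of_hit` + the constants of `exists_KSch_theta_slab_pos_of_target` (`L/KozmaNitzanTheorem6.lean`) and of
`SameP.card_env_le` / `SameP.exists_KSch_lawful` / `SameP.samePWitnessLtOne_zd` (`PercNearOneGluingNoHeavySamePZd.lean`,
`…SamePWitnessZd.lean`).  Helper file (`--supports stmt-CriticalPhenomena-4575`); no sorries.

* `hQ0_of_hit` — (32) at the origin from the site-hittability of the elongated geometry of aspect `6` at scale `3r`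
  (the cube `Q_0` pinned open joins `0` to every vertex of `Λ_{3r}`);
* `card_env_le_of_next` — the uniform envelope bound `(70r + 1)^d` (probe envelopes are the star edges of vertex sets
  inside the cube of radius `35r` around the source centre);
* `exists_SKSch_lawful` — KN §4 with `ε = 2⁻³³` for SITE percolation: from the site target property and the site Lemma 9
  at `p` a scheme `S : SKSch d` with `S.p = p`, `S.δc ≤ 1`, lawful on the star carrier `⊤` at `(p, 2⁻³³)`;
* **`siteSamePWitnessLtOneZd_of_inputs`** — the socket's witness below density one, `SiteSameP.SiteSamePWitnessLtOneZd d`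
  (p1 gen 3, `Transplant/SiteThmASocketLtOneZd.lean`; at `p = 1`, where `θ^{site} = 1`, Kozma–Nitzan's construction and
  the site Lemma 10 — which needs `p < 1` — are not available, and the closing argument only uses `p = p_c^{site} < 1`),
  HOLDS on `ℤ^d`, `d ≥ 3`, given the two inputs at every `0 < p < 1` with `θ^{site}(p) > 0`: the site target property
  (site Lemma 10, prim-bschramm p1) and `SiteLinkedOrthantFace` (site Lemma 9);
* **`sitePercolationContinuity_of_inputs`** (`d ≥ 3`), **`sitePercolationContinuityZ3_of_inputs`** — `θ^{site}_{ℤ^d}(p_c^{site}) = 0`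
  from the two inputs, through `SiteSameP.sitePercolationContinuity_of_siteSamePWitnessLtOneZd` (site Theorem A at
  `p_c^{site} ∈ (0,1)`, `siteCriticalProb_zd_lt_one`).
[cite: KozmaNitzan2024, §1 p. 2 (approach 1), §4 Theorem 6 (pp. 25–31)] [cite: BenjaminiSchramm1996, Conj. 4]
-/

noncomputable section

namespace Summit.CriticalPhenomena.PercolationContinuityZ3.Theorems.Transplant

namespace SiteKN

open MeasureTheory ProbabilityTheory
open Literature.Probability.Percolation Literature.Probability.LatticeModels
open Literature.Probability.Percolation.KozmaNitzan Literature.Probability.Percolation.KozmaNitzan.Cells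
open GadgetSystem ProbeHistory Contour HSiteScheme
open SiteTransplant (siteConn mem_siteConn)
open SiteStar (starEdge starRead starEdge_injective mem_starRead top_adj_none_some starEdge_mem_edgeSet)
open scoped Classical

variable {d : ℕ}

namespace SKSch

/-! ## (32) at the origin from hittability -/

/-- `Λ_{5r} ⊆ Q_0`. [folklore] -/
theorem box_subset_Q_zero (S : SKSch d) : box d (5 * S.C.r) ⊆ S.C.Q 0 := by
  intro y hy
  rw [mem_box] at hy
  rw [Cells.Q, S.C.cen_zero, mem_cIcc_iff]
  intro i; have := hy i; simp only [Pi.zero_apply]; push_cast at this ⊢; constructor <;> linarith [this.1, this.2]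

/-- **(32) for `w = 0`, from the site-hittability of the elongated geometry of aspect `6` at scale `3r`**: under density
`p` with the cube `Q_0` pinned open, `0` is joined to `M_v` inside `Q_0 ∪ E_{0,v}` with probability `> 1 − δ`.
[cite: KozmaNitzan2024, §4 p. 28 ((32) for w = 0)] -/
theorem hQ0_of_hit (S : SKSch d) (du : MDir)
    (hhit : 1 - S.δc < (sitePercolation (Site d) S.p).real
      (siteLinkIn (↑((elongGeom (S.C.axOf du) (σu du) 6 (by norm_num)).Qset (3 * S.C.r) 0)) (box d (3 * S.C.r))
        ((elongGeom (S.C.axOf du) (σu du) 6 (by norm_num)).Fset (3 * S.C.r) 0))) :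
    1 - S.δc < (prodBernoulli (pinW (fun _ : Site d => S.p) ↑S.U₀V ↑S.U₀V)).real
      (⋃ t ∈ (↑(S.C.M ((0 : Site 2) + stepVec du)) : Set (Site d)),
        siteConnIn (zdGraph d) (↑(S.C.Q 0 ∪ S.C.Ewv 0 du) : Set (Site d)) 0 t) := by
  set g := elongGeom (S.C.axOf du) (σu du) 6 (by norm_num) with hg
  have hσ := sgOf_sign du
  have hr1 : (1 : ℤ) ≤ S.C.r := by exact_mod_cast S.C.r_pos
  -- geometry
  have hQset : g.Qset (3 * S.C.r) 0 ⊆ S.C.Q 0 ∪ S.C.Ewv 0 du := by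
    intro y hy
    have hy' : y ∈ S.C.bigD 0 du := by
      rw [hg, elongGeom_Qset_eq, σu_val] at hy
      rw [Cells.bigD, S.C.cen_zero]
      refine sBox_mono hσ 0 ?_ ?_ ?_ hy <;> push_cast <;> linarith
    rcases S.C.mem_Q_or_Efar_of_mem_bigD hy' with h | h
    · exact Finset.mem_union_left _ h
    · exact Finset.mem_union_right _ (S.C.Efar_subset_Ewv _ _ h)
  have hFset : g.Fset (3 * S.C.r) 0 ⊆ S.C.M ((0 : Site 2) + stepVec du) := by
    intro y hy
    rw [hg, elongGeom_Fset_eq, σu_val, mem_sBox_iff hσ] at hy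
    obtain ⟨⟨h1, h2⟩, ht⟩ := hy
    push_cast at h1 h2 ht
    rw [Cells.M, mem_cIcc_iff]
    intro i
    rw [S.C.cen_add_stepVec, S.C.cen_zero]
    push_cast
    by_cases hi : i = S.C.axOf du
    · subst hi
      rw [if_pos rfl]
      have hsq := sign_mul_self hσ
      have hb : -(3 * (S.C.r : ℤ)) ≤ sgOf du * (y (S.C.axOf du) - ((0 : Site d) (S.C.axOf du) + 20 * S.C.r * sgOf du)) ∧
          sgOf du * (y (S.C.axOf du) - ((0 : Site d) (S.C.axOf du) + 20 * S.C.r * sgOf du)) ≤ 3 * S.C.r := by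
        have e1 : sgOf du * (y (S.C.axOf du) - ((0 : Site d) (S.C.axOf du) + 20 * S.C.r * sgOf du)) =
            sgOf du * (y (S.C.axOf du) - (0 : Site d) (S.C.axOf du)) - 20 * S.C.r * (sgOf du * sgOf du) := by ring
        rw [e1, hsq]
        constructor <;> linarith
      have := abs_bounds_of_level hσ hb.1 hb.2
      constructor <;> linarith [this.1, this.2]
    · rw [if_neg hi]
      have := ht i hi
      simp only [Pi.zero_apply] at this ⊢
      constructor <;> linarith [this.1, this.2]
  have hbox35 : box d (3 * S.C.r) ⊆ box d (5 * S.C.r) := box_mono d (by omega)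
  have h0box : (0 : Site d) ∈ box d (5 * S.C.r) := zero_mem_box d _
  -- probability
  set E1 := siteLinkIn (↑(g.Qset (3 * S.C.r) 0) : Set (Site d)) (box d (3 * S.C.r)) (g.Fset (3 * S.C.r) 0) with hE1
  have hE1up : IsUpperSet E1 := isUpperSet_siteLinkIn _ _ _
  have hE1m : MeasurableSet E1 := measurableSet_siteLinkIn _ _ _
  have h1 : (sitePercolation (Site d) S.p).real E1 ≤ (prodBernoulli (pinW (fun _ : Site d => S.p) ↑S.U₀V ↑S.U₀V)).real E1 := by
    rw [sitePercolation_eq_prodBernoulli]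
    exact prodBernoulli_real_mono_of_isUpperSet (le_pinW_univ_of_eq _ _) hE1up hE1m
  have h2 : (prodBernoulli (pinW (fun _ : Site d => S.p) ↑S.U₀V ↑S.U₀V)).real E1 =
      (prodBernoulli (pinW (fun _ : Site d => S.p) ↑S.U₀V ↑S.U₀V)).real
        (E1 ∩ localCylinder (↑S.U₀V : Set (Site d)) ↑S.U₀V) :=
    (prodBernoulli_pinW_real_inter_localCylinder _ S.U₀V.finite_toSet.countable _ E1).symm
  have h3 : E1 ∩ localCylinder (↑S.U₀V : Set (Site d)) ↑S.U₀V ⊆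
      ⋃ t ∈ (↑(S.C.M ((0 : Site 2) + stepVec du)) : Set (Site d)),
        siteConnIn (zdGraph d) (↑(S.C.Q 0 ∪ S.C.Ewv 0 du) : Set (Site d)) 0 t := by
    rintro σ ⟨hσ, hcyl⟩
    rw [hE1, mem_siteLinkIn_iff] at hσ
    obtain ⟨s, hs, t, ht, hst⟩ := hσ
    simp only [Set.mem_iUnion, exists_prop]
    refine ⟨t, Finset.mem_coe.2 (hFset ht), ?_⟩
    have hQopen : (↑(box d (5 * S.C.r)) : Set (Site d)) ⊆ σ := fun x hx =>
      (hcyl x (Finset.mem_coe.2 (S.box_subset_Q_zero (Finset.mem_coe.1 hx)))).2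
        (Finset.mem_coe.2 (S.box_subset_Q_zero (Finset.mem_coe.1 hx)))
    have h0s : σ ∈ siteConnIn (zdGraph d) (↑(S.C.Q 0 ∪ S.C.Ewv 0 du) : Set (Site d)) 0 s :=
      siteConnIn_mono (zdGraph d)
        (Finset.coe_subset.2 (S.box_subset_Q_zero.trans Finset.subset_union_left)) 0 s
        (mem_siteConnIn_box_of_subset (5 * S.C.r) h0box (hbox35 hs) hQopen)
    exact siteConnIn_trans (zdGraph d) subset_rfl (Finset.coe_subset.2 hQset) h0s hst
  calc 1 - S.δc < (sitePercolation (Site d) S.p).real E1 := hhit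
    _ ≤ _ := h1
    _ = _ := h2
    _ ≤ _ := measureReal_mono h3 (measure_ne_top _ _)
  where
  /-- pinning a set along itself (all open) only raises the weights -/
  le_pinW_univ_of_eq (w : Site d → unitInterval) (F : Set (Site d)) : w ≤ pinW w F F := by
    intro x
    by_cases hx : x ∈ F
    · rw [pinW_apply_of_mem_of_mem _ hx hx]; exact le_top
    · rw [pinW_apply_of_not_mem _ _ hx]

/-! ## The uniform envelope bound -/

/-- **The envelope region lies in the cube of radius `35r` around the source centre** (`E_{w,v}` in the cells of `w` and
`v`, each stub in the cell of `v` or its zone). [cite: KozmaNitzan2024, §4 p. 26 (Q_v, E_{v,x}, H^j_{v,x})] -/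
theorem envRegion_subset_cube (S : SKSch d) (h : ProbeHistory (Option (Site d))) (e : Site 2 × MDir) :
    ∀ z ∈ S.envRegion h e, z ∈ Finset.Icc (S.C.cen e.1 - ((35 * S.C.r : ℕ) : Site d)) (S.C.cen e.1 + ((35 * S.C.r : ℕ) : Site d)) := by
  intro z hz
  rw [KozmaNitzan.mem_cIcc_iff]
  have hcen : ∀ i, |S.C.cen (tgt e) i - S.C.cen e.1 i| ≤ 20 * S.C.r := by
    intro i
    show |S.C.cen (e.1 + stepVec e.2) i - S.C.cen e.1 i| ≤ _
    rw [S.C.cen_add_stepVec]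
    split_ifs
    · rcases Cells.sgOf_sign e.2 with h1 | h1 <;> rw [h1] <;> simp
    · simp
  have hwC : ∀ i, S.C.wC i ≤ 10 * S.C.r := fun i => by
    unfold Cells.wC; split_ifs <;> omega
  have hCell : ∀ v i, z ∈ S.C.Cell v → |z i - S.C.cen v i| ≤ 10 * S.C.r := by
    intro v i hzv
    rw [Cells.Cell, Finset.mem_Icc] at hzv
    have h1 := hzv.1 i
    have h2 := hzv.2 i
    simp only [Pi.sub_apply, Pi.add_apply] at h1 h2
    have := hwC i
    rw [abs_le]; constructor <;> linarith
  rcases Finset.mem_union.1 hz with hz | hz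
  · rcases Finset.mem_union.1 (S.C.Ewv_subset_Cells e.1 e.2 hz) with hz | hz
    · intro i
      have h1 := hCell e.1 i hz
      rw [abs_le] at h1
      push_cast; constructor <;> linarith
    · intro i
      have h1 := hCell _ i hz
      have h2 := hcen i
      change |z i - S.C.cen (tgt e) i| ≤ _ at h1
      rw [abs_le] at h1 h2
      push_cast; constructor <;> linarith
  · obtain ⟨du, -, hz⟩ := Finset.mem_biUnion.1 hz
    have hK : S.C.K - 1 + 1 ≤ S.C.K := by have := S.C.hK; omega
    rcases Finset.mem_union.1 (S.C.Stub_subset_Cell_union_Zone (tgt e) du hK hz) with hz | hz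
    · intro i
      have h1 := hCell _ i hz
      have h2 := hcen i
      rw [abs_le] at h1 h2
      push_cast; constructor <;> linarith
    · intro i
      rw [Cells.Zone, mem_sBox_iff (Cells.sgOf_sign du)] at hz
      obtain ⟨⟨ha1, ha2⟩, hoth⟩ := hz
      have h2 := hcen i
      rw [abs_le] at h2
      have hs : (0 : ℤ) ≤ S.C.s := by positivity
      by_cases hi : i = S.C.axOf du
      · subst hi
        rcases Cells.sgOf_sign du with h1 | h1 <;> rw [h1] at ha1 ha2 <;> push_cast <;>
          constructor <;> linarith
      · have := hoth i hi
        push_cast; constructor <;> linarith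

/-- **Uniform envelope bound along the site scheme**: every probe examines the star edges of at most `(70r + 1)^d` vertices.
[cite: KozmaNitzan2024, §4 p. 27] -/
theorem card_env_le_of_next (S : SKSch d) :
    ∀ hh P, S.scheme.E.next hh = some P → P.env.card ≤ (2 * (35 * S.C.r) + 1) ^ d := by
  intro hh P hP
  obtain ⟨e, -, -, rfl⟩ := S.nextProbe_eq_some hP
  show (stars (S.envV hh e)).card ≤ _
  rw [stars, Finset.card_map]
  refine (Finset.card_le_card fun z hz => S.envRegion_subset_cube hh e z (Finset.sdiff_subset hz)).trans ?_
  exact KozmaNitzan.card_Icc_le_pow fun k => by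
    simp only [Pi.add_apply, Pi.sub_apply, Pi.natCast_apply]; omega

/-! ## KN §4 with `ε = 2⁻³³` for site percolation: a lawful scheme at every percolating density below one -/

/-- **Kozma–Nitzan's §4 construction for SITE percolation, output as a LAWFUL SCHEME on the star carrier**: from the
site target property and the site Lemma 9 at `p` (`d ≥ 3`), a scheme `S` with `S.p = p`, `S.δc ≤ 1`, lawful at
`(p, 2⁻³³)`.  The constants are those of the bond `SameP.exists_KSch_lawful`. [cite: KozmaNitzan2024, §4 Theorem 6 (pp. 25–31)] -/
theorem exists_SKSch_lawful (hd : 3 ≤ d) (p : unitInterval) (hT : SiteTargetProperty d p) (hL : SiteLinkedOrthantFace d p) :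
    ∃ S : SKSch d, S.p = p ∧ S.δc ≤ 1 ∧
      S.scheme.Lawful (⊤ : SimpleGraph (Option (Site d))) p ((1 / 2) ^ 33) := by
  -- `ε`
  set ε : ℝ := (1 / 2) ^ 33 with hε
  have hε0 : 0 < ε := by positivity
  -- Lemma 12 at `ε / 8`
  obtain ⟨δ, hδ0, m, hcorr⟩ := siteCorridorLemma_of_target hT hL (ε := ε / 8) (by positivity)
  set δc : ℝ := min δ (1 / 2) with hδc
  have hδc0 : 0 < δc := lt_min hδ0 (by norm_num)
  have hδc1 : δc ≤ 1 := (min_le_right _ _).trans (by norm_num)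
  have hδcδ : δc ≤ δ := min_le_left _ _
  -- Lemma 10 at `δc`
  obtain ⟨δ₂, hδ₂0, htgt0⟩ := hT hδc0
  set δ₂' : ℝ := min δ₂ 1 with hδ₂'
  have hδ₂'0 : 0 < δ₂' := lt_min hδ₂0 one_pos
  have hδ₂'1 : δ₂' ≤ 1 := min_le_right _ _
  have hδ₂'2 : δ₂' ≤ δ₂ := min_le_left _ _
  -- `K`
  obtain ⟨K₀, hK₀⟩ := exists_pow_lt_of_lt_one (show 0 < ε / 8 by positivity) (show 1 - δ₂' < 1 by linarith)
  set K : ℕ := max K₀ 20 with hK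
  have hK20 : 20 ≤ K := le_max_right _ _
  have hKε : (1 - δ₂') ^ K + ε / 8 ≤ ε / 4 := by
    have : (1 - δ₂') ^ K ≤ (1 - δ₂') ^ K₀ := pow_le_pow_of_le_one (by linarith) (by linarith) (le_max_left _ _)
    linarith
  -- `R`
  have hK2 : 2 ≤ 2 * K := by omega
  obtain ⟨R, hR⟩ := htgt0 (elongList d (2 * K) (by omega)) (siteIsHittable_of_mem_elongList_of_target hT hL (2 * K) hK2)
  -- the hittability thresholds for (32) at the origin
  set C₀ : Cells d := ⟨hd, 20, 1, le_rfl, le_rfl⟩ with hC₀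
  have hhit6 : ∀ du : MDir, ∃ kℓ : ℕ, ∀ m', kℓ ≤ m' → ∀ ℓ, kℓ ≤ ℓ →
      1 - δc < (sitePercolation (Site d) p).real
        (siteLinkIn (↑((elongGeom (C₀.axOf du) (σu du) 6 (by norm_num)).Qset ℓ 0)) (box d m')
          ((elongGeom (C₀.axOf du) (σu du) 6 (by norm_num)).Fset ℓ 0)) := by
    intro du
    obtain ⟨k, ℓ₀, h⟩ := (siteIsHittable_elongGeom_of_target hT hL (C₀.axOf du) (σu du) 6 (by norm_num)).hit δc hδc0
    exact ⟨max k ℓ₀, fun m' hm' ℓ hℓ => h m' ((le_max_left _ _).trans hm') ℓ ((le_max_right _ _).trans hℓ)⟩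
  choose kℓ hkℓ using hhit6
  set kmax : ℕ := Finset.univ.sup kℓ with hkmax
  have hkmax' : ∀ du, kℓ du ≤ kmax := fun du => Finset.le_sup (f := kℓ) (Finset.mem_univ du)
  -- `s` and the scheme
  set s : ℕ := max (max (max 1 (2 * R)) m) kmax with hs
  have hs1 : 1 ≤ s := le_trans (le_trans (le_max_left _ _) (le_max_left _ _)) (le_max_left _ _)
  have hsR : 2 * R ≤ s := le_trans (le_trans (le_max_right _ _) (le_max_left _ _)) (le_max_left _ _)
  have hsm : m ≤ s := le_trans (le_max_right _ _) (le_max_left _ _)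
  have hsk : kmax ≤ s := le_max_right _ _
  set C : Cells d := ⟨hd, K, s, hK20, hs1⟩ with hCdef
  set S : SKSch d := ⟨⟨C, p, δc⟩⟩ with hSdef
  refine ⟨S, rfl, hδc1, ?_⟩
  have hsr : s ≤ C.r := by
    show s ≤ K * s
    exact Nat.le_mul_of_pos_left s (by omega)
  -- lawfulness
  refine S.lawful (fun du => ?_) (fun h e hV => ?_)
  · refine S.hQ0_of_hit du (hkℓ du (3 * C.r) ?_ (3 * C.r) ?_) <;> linarith [hkmax' du]
  · refine fail_bound hV hε0.le hδ₂'1 (R := R) (fun T w hT' hTr hyp => ?_)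
      (fun w Sfin D lo hi T o h1 h2 h3 h4 h5 h6 h7 h8 h9 h10 => ?_) hsR hKε
    · refine hcorr T w hT' ?_ (lt_of_le_of_lt (by show 1 - δ ≤ 1 - S.δc; linarith) hyp)
      rw [hTr]; exact hsm.trans hsr
    · exact hR w Sfin D lo hi T o h1 h2 h3 h4 h5 h6 h7 h8 h9
        (lt_of_le_of_lt (by show 1 - δ₂ ≤ 1 - δ₂'; linarith) h10)

/-! ## The site same-`p` witness below density one holds -/

/-- **The site same-`p` witness below one HOLDS on `ℤ^d`, `d ≥ 3`, from the two inputs**: at every density `0 < p < 1`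
with `θ^{site}(p) > 0`, the site target property (site Lemma 10) and `SiteLinkedOrthantFace` (site Lemma 9) give the
site exploration scheme — bounded range, lawful at `(p, 2⁻³³)`, whose infinite macro-cluster forces `0 ↔^{site} ∞`.
[cite: KozmaNitzan2024, §4 Theorem 6 (pp. 25–31)] -/
theorem siteSamePWitnessLtOneZd_of_inputs (hd : 3 ≤ d)
    (hT : ∀ p : unitInterval, 0 < (p : ℝ) → (p : ℝ) < 1 → 0 < siteTheta (zdGraph d) (0 : Site d) p → SiteTargetProperty d p)
    (hL : ∀ p : unitInterval, 0 < (p : ℝ) → (p : ℝ) < 1 → 0 < siteTheta (zdGraph d) (0 : Site d) p → SiteLinkedOrthantFace d p) :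
    SiteSameP.SiteSamePWitnessLtOneZd d := by
  intro p hp1 hθ
  have hp0 : 0 < (p : ℝ) := by
    rcases p.2.1.eq_or_lt with h0 | h0
    · exfalso
      have e : p = 0 := Subtype.ext h0.symm
      rw [e, SiteSameP.siteTheta_zero] at hθ
      exact lt_irrefl _ hθ
    · exact h0
  obtain ⟨S, hSp, hδc, hLaw⟩ := exists_SKSch_lawful hd p (hT p hp0 hp1 hθ) (hL p hp0 hp1 hθ)
  refine ⟨S.scheme, (1 / 2) ^ 33, (2 * (35 * S.C.r) + 1) ^ d, hLaw, by norm_num, S.card_env_le_of_next, ?_, ?_⟩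
  · intro x hx
    obtain ⟨v, -, rfl⟩ := mem_stars_iff.1 (Finset.mem_coe.1 hx)
    exact starEdge_mem_edgeSet top_adj_none_some v
  · rintro ω ⟨hA, hinf⟩
    exact Or.inl (mem_sitePercolatesAt_of_infinite hδc hA hinf)

/-! ## `θ^{site}_{ℤ^d}(p_c^{site}) = 0` -/

/-- **`θ^{site}_{ℤ^d}(p_c^{site}(ℤ^d)) = 0` for `d ≥ 3` from the two inputs** (site Lemma 10 as the site target property,
site Lemma 9 as `SiteLinkedOrthantFace`, each at every `0 < p < 1` with `θ^{site}(p) > 0`). [cite: BenjaminiSchramm1996, Conj. 4] -/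
theorem sitePercolationContinuity_of_inputs (hd : 3 ≤ d)
    (hT : ∀ p : unitInterval, 0 < (p : ℝ) → (p : ℝ) < 1 → 0 < siteTheta (zdGraph d) (0 : Site d) p → SiteTargetProperty d p)
    (hL : ∀ p : unitInterval, 0 < (p : ℝ) → (p : ℝ) < 1 → 0 < siteTheta (zdGraph d) (0 : Site d) p → SiteLinkedOrthantFace d p) :
    SitePercolationContinuity d :=
  SiteSameP.sitePercolationContinuity_of_siteSamePWitnessLtOneZd d (by omega) (siteSamePWitnessLtOneZd_of_inputs hd hT hL)

/-- **At `d = 3`: the lane's class-C1a target from the two inputs.** [cite: BenjaminiSchramm1996, Conj. 4] -/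
theorem sitePercolationContinuityZ3_of_inputs
    (hT : ∀ p : unitInterval, 0 < (p : ℝ) → (p : ℝ) < 1 → 0 < siteTheta (zdGraph 3) (0 : Site 3) p → SiteTargetProperty 3 p)
    (hL : ∀ p : unitInterval, 0 < (p : ℝ) → (p : ℝ) < 1 → 0 < siteTheta (zdGraph 3) (0 : Site 3) p → SiteLinkedOrthantFace 3 p) :
    SitePercolationContinuityZ3 :=
  sitePercolationContinuity_of_inputs le_rfl hT hL

end SKSch

end SiteKN

end Summit.CriticalPhenomena.PercolationContinuityZ3.Theorems.Transplant

end
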